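import Mathlib
import Literature.Computability.AlgebraicComplexity.NewtonPolygonTauProductBounds
import Summits.ValiantsHypothesis.ValiantsHypothesis.Theorems.NewtonUnitEquationsDissociatedUniformTotalsLaw
import Summits.ValiantsHypothesis.ValiantsHypothesis.Theorems.NewtonUnitEquationsDissociatedUniformTotalsLawLatticeCharts
import HarnessLib

/-!
# Crux `NewtonUnitEquations.DissociatedUniform` (stmt-ValiantsHypothesis-5905): the `n = 3` totals law — the LATTICE STRATUM
# (a Jarník-type bound: an integer point set in a box of side `≤ (J+1)³` has `≤ 12(J+1)² + 4` hull vertices; the law, pointwise,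
# for integer curves on grids of side up to `|G|^{3/2}/3`)

Memo `Cruxes/DissociatedUniform/NOTES-t1g17.md` §2.  Assembly over `…TotalsLawLatticeCharts` (`card_restrictedTops_le`: along a
restricted half-chart `(σ, t)`, `|t| ≤ 1`, an integer set of height extent `≤ N ≤ (J+1)³` has `≤ 3(J+1)² + 1` tops).  Here first
`exists_restricted_chart` / `ncard_extremePoints_le_restricted`: the four restricted half-charts of `F` and of its coordinate swap
(`isStrictTop_swap`) cover all hull vertices (normalise an exposing weight by its larger coordinate); then:
* **`ncard_extremePoints_le_of_int`**: `#vert conv F ≤ 12(J+1)² + 4` for integer `F` with both coordinate extents `≤ N ≤ (J+1)³`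
  — the classical `O(side^{2/3})` bound for lattice polygons (Jarník 1926 / Andrews 1963), in the elementary form needed here.
For model (Q**) (`…TotalsLaw`) with curves on the integer grid `{0,…,N}²` every class lies in `{0,…,3N}²`, so POINTWISE
`classVert_le_of_natCoords : V_s ≤ 12(J+1)² + 4` whenever `3N ≤ (J+1)³`, `totalVert_le_of_natCoords : T ≤ |G|(12(J+1)² + 4)`, and
with `3N ≤ |G|·⌊√|G|⌋` (grids of side up to `|G|^{3/2}/3`): **`classVert ≤ 52|G|`, `totalVert ≤ 52|G|²`**
(`classVert_le_card_of_natCoords`, `totalVert_le_sq_of_natCoords`) — the law `TotalsLawThree`-shaped with constant `52` on the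
lattice stratum of resolution `|G|^{3/2}`, extending the resolution-`|G|` AP stratum of `…TotalsLawHeights` (there `T ≤ 2|G|(3N+1)`;
the parabola gadget's class of `q²/4` vertices needs a grid of side `≍ q⁴`, and in general a class with `V` vertices needs side
`≥ (V/16)^{3/2}`).
Honest label: an elementary stratum theorem; `TotalsLawThree C` remains OPEN and is asserted nowhere; nothing here bears on VP ≠ VNP.
[folklore: a convex lattice polygon in a box of side M has O(M^{2/3}) vertices (Jarník 1926; Andrews 1963)]
-/

set_option linter.dupNamespace false -- `ValiantsHypothesis.ValiantsHypothesis` (summit = problem) in every name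

open Matrix Finset
open scoped BigOperators Pointwise

namespace Summit.ValiantsHypothesis.ValiantsHypothesis.Theorems.NewtonUnitEquationsDissociatedUniform

namespace TotalsLaw

open Literature.Computability.AlgebraicComplexity.KPTT.PlanarMinkowski

/-! ### Restricted half-charts `(σ, t)`, `|t| ≤ 1`, and the coordinate swap -/

/-- The coordinate swap of a planar point. -/
private theorem swap_apply (p : Fin 2 → ℝ) : (![p 1, p 0] : Fin 2 → ℝ) 0 = p 1 ∧ (![p 1, p 0] : Fin 2 → ℝ) 1 = p 0 := by
  simp

/-- A `(t, σ)`-top of `F` is a `(σ, t)`-top of the coordinate swap of `F`. [folklore] -/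
theorem isStrictTop_swap {t σ : ℝ} {F : Finset (Fin 2 → ℝ)} {x : Fin 2 → ℝ} (h : IsStrictTop ![t, σ] F x) :
    IsStrictTop ![σ, t] (F.image fun p : Fin 2 → ℝ => (![p 1, p 0] : Fin 2 → ℝ)) ![x 1, x 0] := by
  classical
  refine ⟨Finset.mem_image.2 ⟨x, h.mem, rfl⟩, fun y hy hne => ?_⟩
  obtain ⟨p, hp, rfl⟩ := Finset.mem_image.1 hy
  have hpx : p ≠ x := by rintro rfl; exact hne rfl
  have e := h.lt hp hpx
  simp only [chart_dotProduct] at e ⊢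
  rw [(swap_apply p).1, (swap_apply p).2, (swap_apply x).1, (swap_apply x).2]
  linarith

/-- The coordinate swap is injective. [folklore] -/
theorem swap_injective : Function.Injective fun p : Fin 2 → ℝ => (![p 1, p 0] : Fin 2 → ℝ) := by
  intro p r h
  have h0 := congrFun h 0
  have h1 := congrFun h 1
  simp only [Matrix.cons_val_zero, Matrix.cons_val_one] at h0 h1
  ext i; fin_cases i
  · exact h1
  · exact h0

/-- **Restricted half-charts cover.**  A hull vertex of `F` is a strict `(σ, t)`-top with `σ = ±1`, `|t| ≤ 1`, either of `F`
itself or (after swapping coordinates) of the swapped set. [folklore] -/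
theorem exists_restricted_chart {F : Finset (Fin 2 → ℝ)} {x : Fin 2 → ℝ}
    (hx : x ∈ (convexHull ℝ (F : Set (Fin 2 → ℝ))).extremePoints ℝ) :
    (∃ σ t : ℝ, (σ = 1 ∨ σ = -1) ∧ |t| ≤ 1 ∧ IsStrictTop ![σ, t] F x) ∨
      ∃ σ t : ℝ, (σ = 1 ∨ σ = -1) ∧ |t| ≤ 1 ∧
        IsStrictTop ![σ, t] (F.image fun p : Fin 2 → ℝ => (![p 1, p 0] : Fin 2 → ℝ)) ![x 1, x 0] := by
  obtain ⟨w, hw⟩ := exists_isStrictTop_of_mem_extremePoints hx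
  by_cases h0 : w 0 = 0
  · by_cases h1 : w 1 = 0
    · -- `w = 0`: then `F = {x}` and any weight works
      refine Or.inl ⟨1, 0, Or.inl rfl, by simp, hw.mem, fun y hy hne => ?_⟩
      have e := hw.lt hy hne
      have hw0 : w = 0 := by ext i; fin_cases i <;> assumption
      simp [hw0] at e
    · -- `|w 0| = 0 < |w 1|`: swapped chart with `t = 0`
      right
      have hpos : 0 < |w 1|⁻¹ := inv_pos.2 (abs_pos.2 h1)
      have hs := hw.smul_pos hpos
      have hcw : |w 1|⁻¹ • w = ![|w 1|⁻¹ * w 0, |w 1|⁻¹ * w 1] := by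
        ext i; fin_cases i <;> simp [smul_eq_mul]
      rw [hcw, h0, mul_zero] at hs
      refine ⟨|w 1|⁻¹ * w 1, 0, ?_, by simp, isStrictTop_swap hs⟩
      rcases lt_or_gt_of_ne h1 with hneg | hpos'
      · right; rw [abs_of_neg hneg, inv_neg, neg_mul, inv_mul_cancel₀ hneg.ne]
      · left; rw [abs_of_pos hpos', inv_mul_cancel₀ hpos'.ne']
  · by_cases hle : |w 1| ≤ |w 0|
    · -- chart `(σ, t)` with `t = w 1 / |w 0|`
      left
      have hpos : 0 < |w 0|⁻¹ := inv_pos.2 (abs_pos.2 h0)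
      have hs := hw.smul_pos hpos
      have hcw : |w 0|⁻¹ • w = ![|w 0|⁻¹ * w 0, |w 0|⁻¹ * w 1] := by
        ext i; fin_cases i <;> simp [smul_eq_mul]
      rw [hcw] at hs
      refine ⟨|w 0|⁻¹ * w 0, |w 0|⁻¹ * w 1, ?_, ?_, hs⟩
      · rcases lt_or_gt_of_ne h0 with hneg | hpos'
        · right; rw [abs_of_neg hneg, inv_neg, neg_mul, inv_mul_cancel₀ hneg.ne]
        · left; rw [abs_of_pos hpos', inv_mul_cancel₀ hpos'.ne']
      · rw [abs_mul, abs_inv, abs_abs, ← div_eq_inv_mul]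
        exact div_le_one_of_le₀ hle (abs_nonneg _)
    · -- swapped chart `(σ, t)` with `σ = w 1/|w 1|`, `t = w 0/|w 1|`
      right
      push Not at hle
      have h1 : w 1 ≠ 0 := fun h => by rw [h, abs_zero] at hle; exact (abs_nonneg _).not_gt hle
      have hpos : 0 < |w 1|⁻¹ := inv_pos.2 (abs_pos.2 h1)
      have hs := hw.smul_pos hpos
      have hcw : |w 1|⁻¹ • w = ![|w 1|⁻¹ * w 0, |w 1|⁻¹ * w 1] := by
        ext i; fin_cases i <;> simp [smul_eq_mul]
      rw [hcw] at hs
      refine ⟨|w 1|⁻¹ * w 1, |w 1|⁻¹ * w 0, ?_, ?_, isStrictTop_swap hs⟩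
      · rcases lt_or_gt_of_ne h1 with hneg | hpos'
        · right; rw [abs_of_neg hneg, inv_neg, neg_mul, inv_mul_cancel₀ hneg.ne]
        · left; rw [abs_of_pos hpos', inv_mul_cancel₀ hpos'.ne']
      · rw [abs_mul, abs_inv, abs_abs, ← div_eq_inv_mul]
        exact div_le_one_of_le₀ hle.le (abs_nonneg _)

open Classical in
/-- **`#vert conv F ≤` the four restricted half-chart counts** (of `F` and of its coordinate swap). [folklore] -/
theorem ncard_extremePoints_le_restricted (F : Finset (Fin 2 → ℝ)) :
    ((convexHull ℝ (F : Set (Fin 2 → ℝ))).extremePoints ℝ).ncard ≤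
      (F.filter fun x => ∃ t : ℝ, |t| ≤ 1 ∧ IsStrictTop ![1, t] F x).card +
      (F.filter fun x => ∃ t : ℝ, |t| ≤ 1 ∧ IsStrictTop ![-1, t] F x).card +
      ((F.image fun p : Fin 2 → ℝ => (![p 1, p 0] : Fin 2 → ℝ)).filter fun x => ∃ t : ℝ, |t| ≤ 1 ∧
        IsStrictTop ![1, t] (F.image fun p : Fin 2 → ℝ => (![p 1, p 0] : Fin 2 → ℝ)) x).card +
      ((F.image fun p : Fin 2 → ℝ => (![p 1, p 0] : Fin 2 → ℝ)).filter fun x => ∃ t : ℝ, |t| ≤ 1 ∧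
        IsStrictTop ![-1, t] (F.image fun p : Fin 2 → ℝ => (![p 1, p 0] : Fin 2 → ℝ)) x).card := by
  classical
  set sw : (Fin 2 → ℝ) → (Fin 2 → ℝ) := fun p => ![p 1, p 0] with hsw
  set F' := F.image sw with hF'
  set R₁ := F.filter fun x => ∃ t : ℝ, |t| ≤ 1 ∧ IsStrictTop ![1, t] F x
  set R₂ := F.filter fun x => ∃ t : ℝ, |t| ≤ 1 ∧ IsStrictTop ![-1, t] F x
  set R₃ := F'.filter fun x => ∃ t : ℝ, |t| ≤ 1 ∧ IsStrictTop ![1, t] F' x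
  set R₄ := F'.filter fun x => ∃ t : ℝ, |t| ≤ 1 ∧ IsStrictTop ![-1, t] F' x
  -- preimages of the swapped charts
  set S₃ := F.filter fun x => sw x ∈ R₃
  set S₄ := F.filter fun x => sw x ∈ R₄
  have hV : ((convexHull ℝ (F : Set (Fin 2 → ℝ))).extremePoints ℝ).ncard ≤ (R₁ ∪ R₂ ∪ S₃ ∪ S₄).card := by
    rw [extremePoints_eq_coe_filter_charts F, Set.ncard_coe_finset]
    refine Finset.card_le_card fun x hx => ?_
    obtain ⟨hxF, hx'⟩ := Finset.mem_filter.1 hx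
    have hxE : x ∈ (convexHull ℝ (F : Set (Fin 2 → ℝ))).extremePoints ℝ := by
      rw [extremePoints_eq_coe_filter_charts F]; exact hx
    simp only [Finset.mem_union]
    rcases exists_restricted_chart hxE with ⟨σ, t, hσ, ht, hs⟩ | ⟨σ, t, hσ, ht, hs⟩
    · rcases hσ with rfl | rfl
      · exact Or.inl (Or.inl (Or.inl (Finset.mem_filter.2 ⟨hxF, t, ht, hs⟩)))
      · exact Or.inl (Or.inl (Or.inr (Finset.mem_filter.2 ⟨hxF, t, ht, hs⟩)))
    · rcases hσ with rfl | rfl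
      · exact Or.inl (Or.inr (Finset.mem_filter.2 ⟨hxF, Finset.mem_filter.2 ⟨Finset.mem_image_of_mem _ hxF, t, ht, hs⟩⟩))
      · exact Or.inr (Finset.mem_filter.2 ⟨hxF, Finset.mem_filter.2 ⟨Finset.mem_image_of_mem _ hxF, t, ht, hs⟩⟩)
  have hS₃ : S₃.card ≤ R₃.card :=
    Finset.card_le_card_of_injOn sw (fun x hx => Finset.mem_coe.2 (Finset.mem_filter.1 (Finset.mem_coe.1 hx)).2)
      (swap_injective.injOn)
  have hS₄ : S₄.card ≤ R₄.card :=
    Finset.card_le_card_of_injOn sw (fun x hx => Finset.mem_coe.2 (Finset.mem_filter.1 (Finset.mem_coe.1 hx)).2)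
      (swap_injective.injOn)
  calc _ ≤ (R₁ ∪ R₂ ∪ S₃ ∪ S₄).card := hV
    _ ≤ (R₁ ∪ R₂ ∪ S₃).card + S₄.card := Finset.card_union_le _ _
    _ ≤ (R₁ ∪ R₂).card + S₃.card + S₄.card := by gcongr; exact Finset.card_union_le _ _
    _ ≤ R₁.card + R₂.card + S₃.card + S₄.card := by gcongr; exact Finset.card_union_le _ _
    _ ≤ R₁.card + R₂.card + R₃.card + R₄.card := by gcongr

/-! ### The Jarník-type bound for integer point sets -/

open Classical in
/-- **Integer point sets in a box of side `≤ (J+1)³` have `≤ 12(J+1)² + 4` hull vertices** (the elementary `O(side^{2/3})`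
lattice-polygon bound: four restricted half-charts, `≤ 3(J+1)² + 1` tops each). [folklore] -/
theorem ncard_extremePoints_le_of_int (F : Finset (Fin 2 → ℝ)) (N J : ℕ)
    (hint : ∀ x ∈ F, ∃ z : ℤ × ℤ, x 0 = z.1 ∧ x 1 = z.2) (hN0 : ∀ x ∈ F, ∀ y ∈ F, x 0 - y 0 ≤ N)
    (hN1 : ∀ x ∈ F, ∀ y ∈ F, x 1 - y 1 ≤ N) (hJ : N ≤ (J + 1) ^ 3) :
    ((convexHull ℝ (F : Set (Fin 2 → ℝ))).extremePoints ℝ).ncard ≤ 12 * (J + 1) ^ 2 + 4 := by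
  classical
  set F' := F.image fun p : Fin 2 → ℝ => (![p 1, p 0] : Fin 2 → ℝ) with hF'
  have hint' : ∀ x ∈ F', ∃ z : ℤ × ℤ, x 0 = z.1 ∧ x 1 = z.2 := by
    intro x hx
    obtain ⟨p, hp, rfl⟩ := Finset.mem_image.1 hx
    obtain ⟨z, hz0, hz1⟩ := hint p hp
    exact ⟨(z.2, z.1), by simp [hz0, hz1]⟩
  have hN1' : ∀ x ∈ F', ∀ y ∈ F', x 1 - y 1 ≤ N := by
    intro x hx y hy
    obtain ⟨p, hp, rfl⟩ := Finset.mem_image.1 hx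
    obtain ⟨r, hr, rfl⟩ := Finset.mem_image.1 hy
    simpa using hN0 p hp r hr
  have h1 := card_restrictedTops_le (σ := 1) (Or.inl rfl) F N J hint hN1 hJ
  have h2 := card_restrictedTops_le (σ := -1) (Or.inr rfl) F N J hint hN1 hJ
  have h3 := card_restrictedTops_le (σ := 1) (Or.inl rfl) F' N J hint' hN1' hJ
  have h4 := card_restrictedTops_le (σ := -1) (Or.inr rfl) F' N J hint' hN1' hJ
  have h := ncard_extremePoints_le_restricted F
  rw [← hF'] at h
  omega

/-! ### Model (Q**) with curves on an integer grid -/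

variable {G : Type*} [AddCommGroup G] [Fintype G]

open Classical in
/-- **Pointwise class bound on the lattice stratum.**  If all three curves have natural-number coordinates `≤ N` and
`3N ≤ (J+1)³`, then every class has `V_s ≤ 12(J+1)² + 4` hull vertices. [folklore] -/
theorem classVert_le_of_natCoords (a b c : G → (Fin 2 → ℝ)) (N J : ℕ)
    (ha : ∀ x i, ∃ k : ℕ, k ≤ N ∧ a x i = k) (hb : ∀ y i, ∃ k : ℕ, k ≤ N ∧ b y i = k)
    (hc : ∀ z i, ∃ k : ℕ, k ≤ N ∧ c z i = k) (hJ : 3 * N ≤ (J + 1) ^ 3) (s : G) :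
    classVert a b c s ≤ 12 * (J + 1) ^ 2 + 4 := by
  classical
  set F := Finset.univ.image fun p : G × G => a p.1 + b p.2 + c (s - p.1 - p.2) with hF
  have hcoe : (F : Set (Fin 2 → ℝ)) = classPts a b c s := by
    rw [hF, Finset.coe_image, Finset.coe_univ, Set.image_univ]; rfl
  -- every class point has natural coordinates `≤ 3N`
  have hnat : ∀ v ∈ F, ∀ i, ∃ k : ℕ, k ≤ 3 * N ∧ v i = k := by
    intro v hv i
    obtain ⟨p, -, rfl⟩ := Finset.mem_image.1 hv
    obtain ⟨k₁, hk₁, e₁⟩ := ha p.1 i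
    obtain ⟨k₂, hk₂, e₂⟩ := hb p.2 i
    obtain ⟨k₃, hk₃, e₃⟩ := hc (s - p.1 - p.2) i
    refine ⟨k₁ + k₂ + k₃, by omega, ?_⟩
    simp only [Pi.add_apply, e₁, e₂, e₃]
    push_cast; ring
  have hint : ∀ x ∈ F, ∃ z : ℤ × ℤ, x 0 = z.1 ∧ x 1 = z.2 := by
    intro x hx
    obtain ⟨k₀, -, e₀⟩ := hnat x hx 0
    obtain ⟨k₁, -, e₁⟩ := hnat x hx 1
    exact ⟨((k₀ : ℤ), (k₁ : ℤ)), by rw [e₀]; simp, by rw [e₁]; simp⟩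
  have hext : ∀ i, ∀ x ∈ F, ∀ y ∈ F, x i - y i ≤ (3 * N : ℕ) := by
    intro i x hx y hy
    obtain ⟨k, hk, e⟩ := hnat x hx i
    obtain ⟨k', -, e'⟩ := hnat y hy i
    rw [e, e']
    have h1 : (k : ℝ) ≤ (3 * N : ℕ) := by exact_mod_cast hk
    have h2 : (0 : ℝ) ≤ k' := by exact_mod_cast Nat.zero_le k'
    linarith
  unfold classVert
  rw [← hcoe]
  exact ncard_extremePoints_le_of_int F (3 * N) J hint (hext 0) (hext 1) hJ

open Classical in
/-- **Totals on the lattice stratum: `T ≤ |G|·(12(J+1)² + 4)`** for curves with natural coordinates `≤ N`, `3N ≤ (J+1)³`. [folklore] -/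
theorem totalVert_le_of_natCoords (a b c : G → (Fin 2 → ℝ)) (N J : ℕ)
    (ha : ∀ x i, ∃ k : ℕ, k ≤ N ∧ a x i = k) (hb : ∀ y i, ∃ k : ℕ, k ≤ N ∧ b y i = k)
    (hc : ∀ z i, ∃ k : ℕ, k ≤ N ∧ c z i = k) (hJ : 3 * N ≤ (J + 1) ^ 3) :
    totalVert a b c ≤ Fintype.card G * (12 * (J + 1) ^ 2 + 4) := by
  unfold totalVert
  calc ∑ s, classVert a b c s ≤ ∑ _s : G, (12 * (J + 1) ^ 2 + 4) :=
        Finset.sum_le_sum fun s _ => classVert_le_of_natCoords a b c N J ha hb hc hJ s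
    _ = Fintype.card G * (12 * (J + 1) ^ 2 + 4) := by rw [Finset.sum_const, Finset.card_univ, smul_eq_mul]

omit [AddCommGroup G] in
/-- `(⌊√q⌋ + 1)² ≤ 4q` and `q⌊√q⌋ ≤ (⌊√q⌋ + 1)³` for `q = |G| ≥ 1`. [folklore] -/
private theorem sqrt_bounds {q : ℕ} (hq : 1 ≤ q) :
    (Nat.sqrt q + 1) ^ 2 ≤ 4 * q ∧ q * Nat.sqrt q ≤ (Nat.sqrt q + 1) ^ 3 := by
  have h1 : Nat.sqrt q ^ 2 ≤ q := Nat.sqrt_le' q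
  have h2 : q < (Nat.sqrt q + 1) ^ 2 := Nat.lt_succ_sqrt' q
  have h3 : Nat.sqrt q ≤ q := Nat.sqrt_le_self q
  constructor
  · nlinarith
  · calc q * Nat.sqrt q ≤ (Nat.sqrt q + 1) ^ 2 * (Nat.sqrt q + 1) := Nat.mul_le_mul h2.le (Nat.le_succ _)
      _ = (Nat.sqrt q + 1) ^ 3 := by ring

/-- **The law on grids of side up to `|G|^{3/2}/3`, pointwise: `V_s ≤ 52|G|`.** [folklore] -/
theorem classVert_le_card_of_natCoords (a b c : G → (Fin 2 → ℝ)) (N : ℕ)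
    (ha : ∀ x i, ∃ k : ℕ, k ≤ N ∧ a x i = k) (hb : ∀ y i, ∃ k : ℕ, k ≤ N ∧ b y i = k)
    (hc : ∀ z i, ∃ k : ℕ, k ≤ N ∧ c z i = k) (hN : 3 * N ≤ Fintype.card G * Nat.sqrt (Fintype.card G)) (s : G) :
    classVert a b c s ≤ 52 * Fintype.card G := by
  have hq : 1 ≤ Fintype.card G := Fintype.card_pos
  obtain ⟨h4, hcube⟩ := sqrt_bounds hq
  have h := classVert_le_of_natCoords a b c N (Nat.sqrt (Fintype.card G)) ha hb hc (hN.trans hcube) s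
  omega

/-- **The law on grids of side up to `|G|^{3/2}/3`: `T ≤ 52|G|²`.** [folklore] -/
theorem totalVert_le_sq_of_natCoords (a b c : G → (Fin 2 → ℝ)) (N : ℕ)
    (ha : ∀ x i, ∃ k : ℕ, k ≤ N ∧ a x i = k) (hb : ∀ y i, ∃ k : ℕ, k ≤ N ∧ b y i = k)
    (hc : ∀ z i, ∃ k : ℕ, k ≤ N ∧ c z i = k) (hN : 3 * N ≤ Fintype.card G * Nat.sqrt (Fintype.card G)) :
    totalVert a b c ≤ 52 * Fintype.card G ^ 2 := by
  unfold totalVert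
  calc ∑ s, classVert a b c s ≤ ∑ _s : G, 52 * Fintype.card G :=
        Finset.sum_le_sum fun s _ => classVert_le_card_of_natCoords a b c N ha hb hc hN s
    _ = 52 * Fintype.card G ^ 2 := by rw [Finset.sum_const, Finset.card_univ, smul_eq_mul]; ring

end TotalsLaw

end Summit.ValiantsHypothesis.ValiantsHypothesis.Theorems.NewtonUnitEquationsDissociatedUniform
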